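import Mathlib.Algebra.Group.Fin.Basic
import Literature.Computability.Cryptography.QuantumQuery
import Literature.Computability.Cryptography.QuantumCircuit
import Literature.Computability.QuantumComplexity.PolynomialMethod
import HarnessLib

/-!
# Every Boolean function has an `N`-query exact quantum algorithm

Beals–Buhrman–Cleve–Mosca–de Wolf, *Quantum lower bounds by polynomials*, J. ACM 48 (2001), §3
(the query model; "Note that `Q₂(f) ≤ Q₀(f) ≤ Q_E(f) ≤ D(f) ≤ N`", p. 6) and §4 ("Since `N` queries
always suffice, even classically", p. 7), for the tree's query
model `QQueryAlg` of `QuantumQuery.lean`, whose docstring describes the witness: "query all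
bits into the workspace, then apply a permutation reading off `f`". This is the content of the
tree facts `exists_computesWithError_zero` / `exists_computesWithError_of_nonneg` and is what
makes `quantumQueryComplexityOn ε D f` an ATTAINED infimum for `N ≠ 0`, `0 ≤ ε`
(`exists_queries_eq_quantumQueryComplexityOn`) — needed by every lower-bound argument on `Q_ε`.

Construction (`exactAlg f`): workspace `W = (Fin N → Bool)`; start `|0, 0, 0^N⟩`; `U_0 = 1`;
`U_1 = ⋯ = U_N =` the permutation matrix moving `|i, b, w⟩` to `|i+1, w_i, w[i := b]⟩`
(`recordPerm`; indices mod `N`). Before the `j`-th query the state is the basis state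
`|j, 0, x_0 … x_{j-1} 0 … 0⟩` (`recorded x j`); the query writes `x_j` into the target, the
permutation files it into the workspace and clears the target (`exactAlg_finalState`, by the
`Fin.foldl` invariant principle of `PolynomialMethod.lean`); after `N` rounds the state is
`|0, 0, x⟩` and the algorithm accepts iff `f x = 1` (`accept = {s | f s.2.2 = 1}`), so it
computes `f` with error `0` (`exactAlg_computesWithError`).

Discharges (D-0014) of the named facts of `QuantumQuery.lean` that rest on this construction:
`exists_computesWithError_zero_holds`, `exists_computesWithError_of_nonneg_holds`,
`quantumQueryComplexityOn_le_holds`, `quantumQueryComplexity_le_holds` (`Q_ε(f) ≤ N`),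
`quantumQueryComplexityOn_anti_holds`, `quantumQueryComplexity_anti_holds` (monotonicity), the
last four by the interim proofs preserved as comments in `QuantumQuery.lean`
(`QQueryAlg.acceptProb_le_one` is discharged in `PolynomialMethod.lean`).

## References

* R. Beals, H. Buhrman, R. Cleve, M. Mosca, R. de Wolf, *Quantum lower bounds by polynomials*,
  J. ACM 48 (2001) 778–797, §3 (Preliminaries: the model, `Q₂(f) ≤ Q₀(f) ≤ Q_E(f) ≤ D(f) ≤ N`,
  p. 6) and §4 ("`N` queries always suffice", p. 7) (arXiv:quant-ph/9802049) [BealsEtAl2001].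
* H. Buhrman, R. de Wolf, *Complexity measures and decision tree complexity: a survey*,
  Theoret. Comput. Sci. 288 (2002), §3 [Wolf2002] (the source cited by the discharged facts of
  `QuantumQuery.lean`).
-/

namespace Literature.Computability.QuantumComplexity

open Matrix Literature.Computability.Cryptography

/-- A permutation matrix maps the basis vector `e_s` to `e_{σ⁻¹ s}` (Mathlib
`Matrix.permMatrix_mulVec`). [folklore] -/
theorem permMatrix_mulVec_single {n : Type*} [Fintype n] [DecidableEq n] (σ : Equiv.Perm n)
    (s : n) (c : ℂ) : σ.permMatrix ℂ *ᵥ Pi.single s c = Pi.single (σ.symm s) c := by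
  funext i
  rw [Matrix.permMatrix_mulVec, Function.comp_apply]
  by_cases h : i = σ.symm s
  · subst h; simp
  · rw [Pi.single_eq_of_ne h, Pi.single_eq_of_ne]
    intro h'
    exact h (by rw [← h', Equiv.symm_apply_apply])

variable {N : ℕ}

/-- The bookkeeping permutation of the `N`-query algorithm: swap the target bit with the `i`-th
workspace bit and advance the index register, `(i, b, w) ↦ (i + 1, w i, w[i := b])` (indices
mod `N`). [folklore] -/
def recordPerm (N : ℕ) [NeZero N] : Equiv.Perm (Fin N × Bool × (Fin N → Bool)) where
  toFun s := (s.1 + 1, s.2.2 s.1, Function.update s.2.2 s.1 s.2.1)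
  invFun s := (s.1 - 1, s.2.2 (s.1 - 1), Function.update s.2.2 (s.1 - 1) s.2.1)
  left_inv := by
    rintro ⟨i, b, w⟩
    simp
  right_inv := by
    rintro ⟨i, b, w⟩
    simp

/-- Unfolding lemma for `recordPerm`. [folklore] -/
@[simp] theorem recordPerm_apply [NeZero N] (s : Fin N × Bool × (Fin N → Bool)) :
    recordPerm N s = (s.1 + 1, s.2.2 s.1, Function.update s.2.2 s.1 s.2.1) := rfl

/-- The workspace contents after `j` queries on input `x`: the first `j` bits of `x`, then zeros.
[folklore] -/
def recorded (x : Fin N → Bool) (j : ℕ) : Fin N → Bool := fun i => decide (i.val < j) && x i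

/-- Initially the workspace is empty. [folklore] -/
@[simp] theorem recorded_zero (x : Fin N → Bool) : recorded x 0 = fun _ => false := by
  funext i; simp [recorded]

/-- After `N` queries the workspace holds `x`. [folklore] -/
theorem recorded_self (x : Fin N → Bool) : recorded x N = x := by
  funext i; simp [recorded, i.isLt]

/-- Before the `j`-th query the `j`-th workspace bit is still `0`. [folklore] -/
theorem recorded_apply_self (x : Fin N → Bool) (j : Fin N) : recorded x j j = false := by
  simp [recorded]

/-- Filing `x_j` into the workspace: `(recorded x j)[j := x_j] = recorded x (j+1)`. [folklore] -/
theorem update_recorded (x : Fin N → Bool) (j : Fin N) :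
    Function.update (recorded x j) j (x j) = recorded x (j + 1) := by
  funext i
  by_cases h : i = j
  · subst h; simp [recorded]
  · rw [Function.update_of_ne h]
    have : i.val ≠ j.val := fun h' => h (Fin.ext h')
    simp only [recorded]
    congr 1
    simp only [decide_eq_decide]
    omega

/-- The `N`-query exact algorithm for `f`: query `x_0, …, x_{N-1}` into the workspace, then
accept iff `f` of the workspace is `1` ("query all bits into the workspace, then apply a
permutation reading off `f`"). Reducible, so that `(exactAlg f).W = (Fin N → Bool)` and
`(exactAlg f).queries = N` unfold in instance search. [cite: BealsEtAl2001, §3] -/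
@[reducible] noncomputable def exactAlg [NeZero N] (f : (Fin N → Bool) → Bool) : QQueryAlg N where
  W := Fin N → Bool
  queries := N
  unitaries := fun j => if j = 0 then 1 else
    ⟨((recordPerm N)⁻¹).permMatrix ℂ, permMatrix_mem_unitaryGroup _⟩
  start := (0, false, fun _ => false)
  accept := {s | f s.2.2 = true}

/-- `exactAlg f` makes `N` queries. [cite: BealsEtAl2001, §3] -/
@[simp] theorem exactAlg_queries [NeZero N] (f : (Fin N → Bool) → Bool) :
    (exactAlg f).queries = N := rfl

/-- The final state of `exactAlg f` on input `x` is the basis state `|0, 0, x⟩`. [cite: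
BealsEtAl2001, §3] -/
theorem exactAlg_finalState [NeZero N] (f : (Fin N → Bool) → Bool) (x : Fin N → Bool) :
    (exactAlg f).finalState x = Pi.single ((0 : Fin N), false, x) 1 := by
  have key : (exactAlg f).finalState x =
      Pi.single (Fin.ofNat N (exactAlg f).queries, false, recorded x (exactAlg f).queries)
        1 := by
    unfold QQueryAlg.finalState
    refine foldl_invariant (P := fun (j : ℕ) (ψ : Fin N × Bool × (Fin N → Bool) → ℂ) =>
        ψ = Pi.single (Fin.ofNat N j, false, recorded x j) 1) (exactAlg f).queries
      (fun ψ j => ((exactAlg f).unitaries j.succ).1 *ᵥ (queryOracle x *ᵥ ψ))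
      (((exactAlg f).unitaries 0).1 *ᵥ Pi.single (exactAlg f).start 1) ?_ ?_
    · show ((exactAlg f).unitaries 0).1 *ᵥ Pi.single (exactAlg f).start 1 = _
      have h0 : Fin.ofNat N 0 = 0 := Fin.ext (by simp [Fin.ofNat])
      rw [h0, recorded_zero]
      simp only [exactAlg, ↓reduceIte, Submonoid.coe_one, Matrix.one_mulVec]
    · intro j ψ hψ
      show ((exactAlg f).unitaries j.succ).1 *ᵥ (queryOracle x *ᵥ ψ) = _
      rw [hψ]
      have hj : Fin.ofNat N (j : ℕ) = j := by open Fin.NatCast in simp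
      have hj1 : Fin.ofNat N ((j : ℕ) + 1) = j + 1 := by open Fin.NatCast in simp
      simp only [exactAlg, if_neg (Fin.succ_ne_zero j), queryOracle, permMatrix_mulVec_single, hj]
      rw [← Equiv.Perm.inv_def, ← Equiv.Perm.inv_def, queryPerm_inv, inv_inv, queryPerm_apply,
        queryMap_apply, recordPerm_apply]
      simp only [Bool.false_xor, recorded_apply_self, update_recorded, hj1]
  have hN : Fin.ofNat N N = 0 := by open Fin.NatCast in simp
  rw [key, exactAlg_queries, hN, recorded_self]

/-- `exactAlg f` accepts `x` with probability `1` if `f x = 1` and `0` otherwise. [cite: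
BealsEtAl2001, §3] -/
theorem exactAlg_acceptProb [NeZero N] (f : (Fin N → Bool) → Bool) (x : Fin N → Bool) :
    (exactAlg f).acceptProb x = if f x = true then 1 else 0 := by
  classical
  unfold QQueryAlg.acceptProb
  rw [exactAlg_finalState, Finset.sum_filter]
  dsimp only [exactAlg]
  rw [Finset.sum_eq_single ((0 : Fin N), false, x)]
  · simp only [Set.mem_setOf_eq, Pi.single_eq_same, norm_one, one_pow]
  · intro s _ hs
    rw [Pi.single_eq_of_ne hs]
    simp
  · simp

/-- The `N`-query algorithm computes `f` exactly (error `0` on every input). [cite: BealsEtAl2001,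
§3] -/
theorem exactAlg_computesWithError [NeZero N] (f : (Fin N → Bool) → Bool) :
    (exactAlg f).ComputesWithError 0 Set.univ f := by
  intro x _
  rw [exactAlg_acceptProb]
  constructor <;> intro hx <;> simp [hx]

/-- Every Boolean function on `N ≥ 1` bits is computed exactly by an `N`-query quantum
algorithm (the content of the tree fact `exists_computesWithError_zero`; "`N` queries always
suffice, even classically"). [cite: BealsEtAl2001, §4 (p. 7) and §3 (p. 6)] -/
theorem exists_queries_eq_computesWithError_zero [NeZero N] (f : (Fin N → Bool) → Bool) :
    ∃ A : QQueryAlg N, A.queries = N ∧ A.ComputesWithError 0 Set.univ f :=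
  ⟨exactAlg f, rfl, exactAlg_computesWithError f⟩

/-- For `N ≠ 0` and `0 ≤ ε`, the infimum defining `quantumQueryComplexityOn ε D f` is
attained: some algorithm with exactly `Q_ε(f)` queries computes `f` with error `ε` on `D`. [cite:
BealsEtAl2001, §3] -/
theorem exists_queries_eq_quantumQueryComplexityOn [NeZero N] {ε : ℝ} (hε : 0 ≤ ε)
    (D : Set (Fin N → Bool)) (f : (Fin N → Bool) → Bool) :
    ∃ A : QQueryAlg N, A.queries = quantumQueryComplexityOn ε D f ∧ A.ComputesWithError ε D f :=
  Nat.sInf_mem (s := {T | ∃ A : QQueryAlg N, A.queries = T ∧ A.ComputesWithError ε D f})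
    ⟨N, exactAlg f, rfl, (exactAlg_computesWithError f).mono hε (Set.subset_univ D)⟩

/-! ### Discharges of the named facts of `QuantumQuery.lean` -/

/-- **Discharge of `exists_computesWithError_zero`**: every Boolean function on `N ≥ 1` bits is
computed exactly by an `N`-query algorithm (`exactAlg`). [cite: BealsEtAl2001, §4 (p. 7) and §3 (p.
6)] -/
theorem _root_.Literature.Computability.Cryptography.exists_computesWithError_zero_holds :
    exists_computesWithError_zero (N := N) :=
  fun f => exists_queries_eq_computesWithError_zero f

/-- **Discharge of `exists_computesWithError_of_nonneg`**: for `N ≠ 0` and `0 ≤ ε` some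
`N`-query algorithm computes `f` with error `ε` on any promise set. [cite: Wolf2002, §3] -/
theorem _root_.Literature.Computability.Cryptography.exists_computesWithError_of_nonneg_holds :
    exists_computesWithError_of_nonneg (N := N) :=
  fun hε D f => ⟨exactAlg f, rfl, (exactAlg_computesWithError f).mono hε (Set.subset_univ D)⟩

/-- **Discharge of `quantumQueryComplexityOn_le`**: `Q_ε(f) ≤ N` on any promise set, for
`0 ≤ ε` (for `N = 0` both sides are `0`). [cite: Wolf2002, §3] -/
theorem _root_.Literature.Computability.Cryptography.quantumQueryComplexityOn_le_holds :
    quantumQueryComplexityOn_le (N := N) := by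
  intro ε hε D f
  rcases Nat.eq_zero_or_pos N with rfl | hN
  · rw [quantumQueryComplexityOn_zero_left]
  · haveI : NeZero N := NeZero.of_pos hN
    exact Nat.sInf_le ⟨exactAlg f, rfl, (exactAlg_computesWithError f).mono hε (Set.subset_univ D)⟩

/-- **Discharge of `quantumQueryComplexity_le`**: `Q_ε(f) ≤ N` for `0 ≤ ε`. [cite: Wolf2002, §3] -/
theorem _root_.Literature.Computability.Cryptography.quantumQueryComplexity_le_holds :
    quantumQueryComplexity_le (N := N) :=
  fun ε hε f =>
    Literature.Computability.Cryptography.quantumQueryComplexityOn_le_holds ε hε Set.univ f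

/-- **Discharge of `quantumQueryComplexityOn_anti`**: quantum query complexity is antitone in
the error `ε ≥ 0` and monotone in the promise set. [cite: Wolf2002, §3] -/
theorem _root_.Literature.Computability.Cryptography.quantumQueryComplexityOn_anti_holds :
    quantumQueryComplexityOn_anti (N := N) := by
  intro ε ε' hε hεε' D D' hD f
  rcases Nat.eq_zero_or_pos N with rfl | hN
  · rw [quantumQueryComplexityOn_zero_left, quantumQueryComplexityOn_zero_left]
  · haveI : NeZero N := NeZero.of_pos hN
    obtain ⟨A, hA, h⟩ := exists_queries_eq_quantumQueryComplexityOn hε D f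
    rw [← hA]
    exact Nat.sInf_le ⟨A, rfl, h.mono hεε' hD⟩

/-- **Discharge of `quantumQueryComplexity_anti`**: `Q_{ε'}(f) ≤ Q_ε(f)` for `0 ≤ ε ≤ ε'`.
[cite: Wolf2002, §3] -/
theorem _root_.Literature.Computability.Cryptography.quantumQueryComplexity_anti_holds :
    quantumQueryComplexity_anti (N := N) :=
  fun hε hεε' f =>
    Literature.Computability.Cryptography.quantumQueryComplexityOn_anti_holds hε hεε' subset_rfl f

end Literature.Computability.QuantumComplexity
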